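import Literature.AnabelianGeometry.EtaleTheta.Discharge.Sec2InertiaOfCommutatorAxis
import Literature.AnabelianGeometry.EtaleTheta.ThetaCovers
import HarnessLib

/-!
# [EtTh] §2: at a PRIME `l` the inertia binder `hIx` is «`I_x ⊆ Δ̄_Θ`-preimage and `I_x ⊄ Ker(Δ_X ↠ Δ̄_X)`»

S. Mochizuki, *The étale theta function and its Frobenioid-theoretic manifestations*, Publ. RIMS **45**
(2009) [EtTh], §2, discussion preceding Def. 2.1, PRIMS p. 261 (PDF p. 35): «`1 → Δ̄_Θ → Δ̄_X → Δ̄^ell_X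
→ 1` — where `Δ̄_Θ ≅ (ℤ/lℤ)(1)` … maps the inertia group `I_x ⊆ D_x` isomorphically onto `Δ_Θ`. Thus …
`1 → Δ̄_Θ → D̄_x → G_K → 1`» [cite: MochizukiEtTh2009, Def 2.1 p.35]; [IUTchI] Rmk. 3.1.6 / ERRATUM E1:
`l` is an odd prime in all uses.

Cell abc-iut, layer L2, seat abc-iut-w6-d077 (gen 2); ROW R203/R205 context (abc-iut-L2-t10's hint
2026-08-26T09:51:53Z: «state it as `C ≤ barThetaHat l ∧ C ⊄ barKerHat l` … which is the honest content»).
PROOF-ONLY (0 definitions). Since `[Δ̄_Θ-preimage : Ker(Δ_X ↠ Δ̄_X)] = l` (abc-iut-L2-t10's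
`IsEtThOrigin.relIndex_barKerHat`, `PiCData.relIndex_barKer`), for `l` PRIME the intermediate subgroups are
only the two ends, so for ANY subgroup `H` (no compactness, no cusp hypothesis):

* `ClassTwoBar.sup_eq_iff_of_relIndex_prime` — lattice lemma: `K ≤ T`, `[T : K]` prime ⇒
  (`H ⊔ K = T ↔ H ≤ T ∧ ¬ H ≤ K`);
* `ThetaSetting.IsEtThOrigin.sup_barKerHat_eq_iff_of_prime` — in `Π_X`: `H ⊔ barKerHat l = barThetaHat l ↔
  H ≤ barThetaHat l ∧ ¬ H ≤ barKerHat l` («`H` maps NON-TRIVIALLY into `Δ̄_Θ ≅ ℤ/l`», hence onto);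
* `ThetaSetting.PiCData.sup_barKer_eq_iff_of_prime` and **`PiCData.inertia_sup_barKer_iff_of_prime`** — in
  `Π_C`, for every profinite input bundle `I : D.PiCData PiC` and once-punctured datum `e`: the binder `hIx`
  of `coverDataAx` at a prime `l ≠ 2` is EQUIVALENT to «`D_x ∩ Δ_C ⊆ Δ̄_Θ`-preimage and
  `D_x ∩ Δ_C ⊄ Ker(Δ_X ↠ Δ̄_X)`». The same lattice lemma applies verbatim to abc-iut-L2-t2's interface
  `ThetaCovers.CoverData l` (fields `barKer_le_barTheta`, `relIndex_barKer`), whose field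
  `inertia_sup_barKer` is thus, for prime `l`, the conjunction of an inclusion and a non-inclusion.

HONEST LIMITS: nothing of [EtTh] is asserted; the clauses are hypotheses (no model in the tree satisfies
them, `SettingModelCuspAxis` / p433801); for composite `l` the equivalence fails in general (a subgroup can
map onto a proper non-trivial subgroup of `ℤ/l`); no new `Prop` fact; no side is taken on [IUTchIII]
Cor. 3.12; typed ≠ proved.
-/

noncomputable section

namespace Literature.AnabelianGeometry.EtaleTheta

open _root_.Topology Literature.AnabelianGeometry.SemiGraphs

/-! ## §1. The lattice lemma -/

namespace ClassTwoBar

/-- **Prime relative index leaves no room**: if `K ≤ T` are subgroups with `[T : K]` prime, then for every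
subgroup `H`: `H · K = T` iff `H ⊆ T` and `H ⊄ K` (the only subgroups between `K` and `T` are `K` and `T`).
[cite: MochizukiEtTh2009, Def 2.1 p.35] -/
theorem sup_eq_iff_of_relIndex_prime {G : Type*} [Group G] {K T : Subgroup G} (hKT : K ≤ T)
    (hp : (K.relIndex T).Prime) (H : Subgroup G) : H ⊔ K = T ↔ H ≤ T ∧ ¬ H ≤ K := by
  constructor
  · intro h
    refine ⟨le_sup_left.trans h.le, fun hHK => hp.ne_one ?_⟩
    rw [Subgroup.relIndex_eq_one, ← h]
    exact sup_le hHK le_rfl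
  · rintro ⟨hHT, hHK⟩
    have hKM : K ≤ H ⊔ K := le_sup_right
    have hMT : H ⊔ K ≤ T := sup_le hHT hKT
    have hmul : K.relIndex (H ⊔ K) * (H ⊔ K).relIndex T = K.relIndex T :=
      Subgroup.relIndex_mul_relIndex K (H ⊔ K) T hKM hMT
    rcases (Nat.dvd_prime hp).1 (Dvd.intro_left _ hmul) with h1 | hl
    · exact le_antisymm hMT (Subgroup.relIndex_eq_one.1 h1)
    · exfalso
      rw [hl] at hmul
      have hK1 : K.relIndex (H ⊔ K) = 1 :=
        Nat.eq_of_mul_eq_mul_right hp.pos (by rw [hmul, one_mul])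
      exact hHK (le_sup_left.trans (Subgroup.relIndex_eq_one.1 hK1))

end ClassTwoBar

namespace ThetaSetting

variable {p : ℕ} [Fact p.Prime] {D : ThetaSetting p}

/-! ## §2. In `Π_X` -/

/-- **At a prime `l`**, for a theta setting of [EtTh] origin and ANY subgroup `H ≤ Π_X`:
`H ⊔ Ker(Δ_X ↠ Δ̄_X) = Δ̄_Θ`-preimage iff `H ⊆ Δ̄_Θ`-preimage and `H ⊄ Ker(Δ_X ↠ Δ̄_X)` — `H` maps
non-trivially, hence onto, `Δ̄_Θ ≅ (ℤ/lℤ)(1)` (`[barThetaHat l : barKerHat l] = l`,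
`IsEtThOrigin.relIndex_barKerHat`). [cite: MochizukiEtTh2009, Def 2.1 p.35] -/
theorem IsEtThOrigin.sup_barKerHat_eq_iff_of_prime (hO : D.IsEtThOrigin) {l : ℕ} (hp : l.Prime)
    (h2 : l ≠ 2) (H : Subgroup D.PiHat) :
    H ⊔ D.barKerHat l = D.barThetaHat l ↔ H ≤ D.barThetaHat l ∧ ¬ H ≤ D.barKerHat l := by
  refine ClassTwoBar.sup_eq_iff_of_relIndex_prime (D.barKerHat_le_barThetaHat l) ?_ H
  rw [hO.relIndex_barKerHat l (hp.odd_of_ne_two h2)]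
  exact hp

/-- At the cusp, prime `l`: the §1-side inertia clause `toHat(I_x) ⊔ barKerHat l = barThetaHat l` iff
`toHat(I_x) ⊆ Δ̄_Θ`-preimage and `toHat(I_x) ⊄ Ker(Δ_X ↠ Δ̄_X)`. [cite: MochizukiEtTh2009, Def 2.1 p.35] -/
theorem IsEtThOrigin.inertiaClause_iff_of_prime (hO : D.IsEtThOrigin) {l : ℕ} (hp : l.Prime)
    (h2 : l ≠ 2) (x : D.Pt) :
    (D.inertia x).map D.toHat.toMonoidHom ⊔ D.barKerHat l = D.barThetaHat l ↔
      (D.inertia x).map D.toHat.toMonoidHom ≤ D.barThetaHat l ∧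
        ¬ (D.inertia x).map D.toHat.toMonoidHom ≤ D.barKerHat l :=
  hO.sup_barKerHat_eq_iff_of_prime hp h2 _

/-! ## §3. In `Π_C`: the binder `hIx` at a prime `l` -/

namespace PiCData

variable {PiC : Type} [Group PiC] [TopologicalSpace PiC] [IsTopologicalGroup PiC] [T2Space PiC]
  (I : D.PiCData PiC)

/-- In `Π_C`, prime `l ≠ 2`, ANY subgroup `H`: `H ⊔ barKer l = barTheta l ↔ H ≤ barTheta l ∧ ¬ H ≤ barKer l`
(`[barTheta l : barKer l] = l`, `PiCData.relIndex_barKer`). [cite: MochizukiEtTh2009, Def 2.1 p.35] -/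
theorem sup_barKer_eq_iff_of_prime (e : D.OncePuncturedData) {l : ℕ} (hp : l.Prime) (h2 : l ≠ 2)
    (H : Subgroup PiC) : H ⊔ I.barKer l = I.barTheta l ↔ H ≤ I.barTheta l ∧ ¬ H ≤ I.barKer l := by
  refine ClassTwoBar.sup_eq_iff_of_relIndex_prime (I.barKer_le_barTheta l e) ?_ H
  rw [I.relIndex_barKer l e (hp.odd_of_ne_two h2)]
  exact hp

/-- **The binder `hIx` of `coverDataAx` at a prime `l ≠ 2`** is EQUIVALENT to «`D_x ∩ Δ_C ⊆ Δ̄_Θ`-preimage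
and `D_x ∩ Δ_C ⊄ Ker(Δ_X ↠ Δ̄_X)`» — the inertia maps non-trivially (hence isomorphically from its image)
onto `Δ̄_Θ ≅ (ℤ/lℤ)(1)`. No compactness or cusp hypothesis. [cite: MochizukiEtTh2009, Def 2.1 p.35] -/
theorem inertia_sup_barKer_iff_of_prime (e : D.OncePuncturedData) {l : ℕ} (hp : l.Prime) (h2 : l ≠ 2)
    (x : D.Pt) :
    (I.Dx x ⊓ I.augGK.ker) ⊔ I.barKer l = I.barTheta l ↔
      I.Dx x ⊓ I.augGK.ker ≤ I.barTheta l ∧ ¬ I.Dx x ⊓ I.augGK.ker ≤ I.barKer l :=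
  I.sup_barKer_eq_iff_of_prime e hp h2 _

/-- The direction a constructor uses: inclusion plus non-inclusion give the binder `hIx` (prime `l ≠ 2`).
[cite: MochizukiEtTh2009, Def 2.1 p.35] -/
theorem inertia_sup_barKer_of_le_of_not_le (e : D.OncePuncturedData) {l : ℕ} (hp : l.Prime)
    (h2 : l ≠ 2) (x : D.Pt) (hle : I.Dx x ⊓ I.augGK.ker ≤ I.barTheta l)
    (hne : ¬ I.Dx x ⊓ I.augGK.ker ≤ I.barKer l) :
    (I.Dx x ⊓ I.augGK.ker) ⊔ I.barKer l = I.barTheta l :=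
  (I.inertia_sup_barKer_iff_of_prime e hp h2 x).2 ⟨hle, hne⟩

end PiCData

end ThetaSetting

namespace ThetaCovers.CoverData

universe u

/-- **At the interface** (abc-iut-L2-t2's `ThetaCovers.CoverData l`): for prime `l`, given the fields
`barKer_le_barTheta` and `relIndex_barKer`, an identity `H ⊔ barKer = barTheta` (the shape of the field
`inertia_sup_barKer`) is equivalent to `H ≤ barTheta ∧ ¬ H ≤ barKer`, for every subgroup `H` of `Π_C`.
[cite: MochizukiEtTh2009, Def 2.1 p.35] -/
theorem sup_barKer_eq_iff_of_prime {l : ℕ} (X : ThetaCovers.CoverData.{u} l) (hp : l.Prime)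
    (H : Subgroup X.PiC) : H ⊔ X.barKer = X.barTheta ↔ H ≤ X.barTheta ∧ ¬ H ≤ X.barKer := by
  refine ClassTwoBar.sup_eq_iff_of_relIndex_prime X.barKer_le_barTheta ?_ H
  rw [X.relIndex_barKer]
  exact hp

end ThetaCovers.CoverData

end Literature.AnabelianGeometry.EtaleTheta

end
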